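import Summits.Ventures.HodgeRepro2.T5SU11RadialGreenImproperStable
import Summits.Ventures.HodgeRepro2.T5SU11SoninPolyaGroup
import Summits.Ventures.HodgeRepro2.T5SU11SphericalLpSharp

/-!
# The derivative of the improper Green's solution: `u′ = (φ_λ′/φ_λ) u + B^I/(sinh 2t φ_λ)`, and its bounds

For `u = G^I_λ g = −χ_λ B^I − φ_λ A^I` (row 492) the Wronskian `sinh 2t (φ_λ χ_λ′ − φ_λ′ χ_λ) = −1` eliminates `χ_λ′`
from `u′ = −χ_λ′ B^I − φ_λ′ A^I`:

**`u′ = (φ_λ′/φ_λ) · u + B^I/(sinh 2t · φ_λ)`** (`greenSolI'_eq`).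

For `λ > 2` the logarithmic derivative is bounded, `|φ_λ′| ≤ √μ φ_λ` (row 486), and for a source of the
exponentially decaying class this gives

* **`eventually_abs_greenSolI'_le`** — `u′` is bounded near `0` (`|B^I(t)| ≤ Φ M sinh 2 · t` against `sinh 2t ≥ 2t`);
* **`exists_abs_greenSolI'_le_exp`** — `|u′(t)| ≤ K e^{−ε′ t}` beyond some `T` for every `ε′ < min(ε, λ)` (row 499's
  bounds of `u` and `B^I`, `1/(sinh 2t φ_λ) ≤ C e^{−λ t}`);
* `integrableOn_Ioi_of_bounded_of_decay` — a continuous function on `(0, ∞)`, bounded near `0` and exponentially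
  decaying at infinity, is integrable (the device of the next row).

The energy bracket `E = sinh 2t · u u′` and the energy identity of the resolvent on the class are the next rows.
Nothing is claimed about (N).

Blind lane: Mathlib + the HodgeRepro2 prefix only; no sorry; axioms ⊆ {propext, Classical.choice,
Quot.sound}.
-/

namespace Summit.Ventures.HodgeRepro2.T5SU11ImproperDerivativeIdentity

open Filter Topology MeasureTheory
open Set (Ioi Ioc Icc Ioo)
open T5SU11Cartan T5SU11SphericalFunction T5SU11SphericalBounds T5SU11SphericalContinuous
  T5SU11SphericalSolutionSpaceAll T5SU11SphericalAsymptotic T5SU11SphericalCfun T5SU11SphericalDecay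
  T5SU11SphericalDecayAsymptotic T5SU11SphericalDecayBracket T5SU11SphericalLpSharp T5SU11SoninPolyaGroup
  T5SU11ReductionOfOrder T5SU11ResolventBoundary T5SU11ResolventDiagonalEdge T5SU11RadialGreenImproper
  T5SU11RadialGreenImproperOrigin T5SU11RadialGreenImproperDecaySource T5SU11RadialGreenImproperStable

/-! ### A general integrability criterion -/

/-- A function continuous on `(0, ∞)`, bounded near `0⁺` and exponentially decaying beyond `T` is integrable on
`(0, ∞)`. -/
theorem integrableOn_Ioi_of_bounded_of_decay {F : ℝ → ℝ} (hF : ContinuousOn F (Ioi 0))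
    {B : ℝ} (hB : ∀ᶠ t in 𝓝[>] (0 : ℝ), |F t| ≤ B)
    {K T κ : ℝ} (hκ : 0 < κ) (hK : ∀ t, T ≤ t → |F t| ≤ K * Real.exp (-κ * t)) : IntegrableOn F (Ioi 0) := by
  obtain ⟨δ, hδ, hδB⟩ := mem_nhdsGT_iff_exists_Ioo_subset.mp hB
  have hδ0 : 0 < δ := hδ
  set δ' := δ / 2 with hδ'
  have hδ'0 : 0 < δ' := by positivity
  have hδ'δ : δ' < δ := by rw [hδ']; linarith
  set T' := max T δ' with hT'
  have hδ'T : δ' ≤ T' := le_max_right _ _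
  have hsub : Ioi 0 ⊆ Ioc 0 δ' ∪ Icc δ' T' ∪ Ioi T' := by
    intro t ht
    rcases le_or_gt t δ' with h1 | h1
    · exact Or.inl (Or.inl ⟨ht, h1⟩)
    · rcases le_or_gt t T' with h2 | h2
      · exact Or.inl (Or.inr ⟨h1.le, h2⟩)
      · exact Or.inr h2
  -- on `(0, δ']`: bounded by `B`
  have hI1 : IntegrableOn F (Ioc 0 δ') := by
    have hI : IntegrableOn (fun _ : ℝ => B) (Ioc 0 δ') :=
      integrableOn_const (by rw [Real.volume_Ioc]; exact ENNReal.ofReal_ne_top)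
    refine Integrable.mono' hI ((hF.mono (fun t ht => ht.1)).aestronglyMeasurable measurableSet_Ioc) ?_
    refine (ae_restrict_iff' measurableSet_Ioc).mpr (Eventually.of_forall fun t ht => ?_)
    rw [Real.norm_eq_abs]
    exact hδB ⟨ht.1, lt_of_le_of_lt ht.2 hδ'δ⟩
  -- on `[δ', T']`: continuous
  have hI2 : IntegrableOn F (Icc δ' T') :=
    (hF.mono (fun t ht => lt_of_lt_of_le hδ'0 ht.1)).integrableOn_Icc
  -- beyond `T'`: dominated by `K e^{−κ t}`
  have hI3 : IntegrableOn F (Ioi T') := by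
    have hdom : IntegrableOn (fun t => K * Real.exp (-κ * t)) (Ioi T') :=
      (exp_neg_integrableOn_Ioi T' hκ).const_mul K
    refine Integrable.mono' hdom ((hF.mono (fun t ht => lt_of_le_of_lt (le_trans hδ'0.le hδ'T) ht)).aestronglyMeasurable
      measurableSet_Ioi) ?_
    refine (ae_restrict_iff' measurableSet_Ioi).mpr (Eventually.of_forall fun t ht => ?_)
    rw [Real.norm_eq_abs]
    exact hK t (le_trans (le_max_left _ _) (le_of_lt ht))
  exact ((hI1.union hI2).union hI3).mono_set hsub

section measure

variable [MeasurableSpace Circle] [BorelSpace Circle]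

variable {lam : ℝ} (hlam : 1 < lam) {g : ℝ → ℝ} (hg : ContinuousOn g (Ioi 0))
  {M : ℝ} (hM : ∀ s ∈ Ioc (0 : ℝ) 1, |g s| ≤ M) (hM0 : 0 ≤ M)
  {ε C s₀ : ℝ} (hε : 2 - lam < ε) (hC : ∀ s, s₀ ≤ s → |g s| ≤ C * Real.exp (-ε * s))

include hlam in
/-- **`u′ = (φ_λ′/φ_λ) u + B^I/(sinh 2t φ_λ)`** for `u = G^I_λ g`, on `(0, ∞)` (the Wronskian eliminates `χ_λ′`). -/
theorem greenSolI'_eq {t : ℝ} (ht : 0 < t) :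
    greenSolI' (deriv fun t => sph lam (hyp t)) (sphDecay' lam) (fun t => sph lam (hyp t)) (sphDecay lam) g t
      = deriv (fun t => sph lam (hyp t)) t / sph lam (hyp t)
          * greenSolI (fun t => sph lam (hyp t)) (sphDecay lam) g t
        + greenBI (fun t => sph lam (hyp t)) g t / (Real.sinh (2 * t) * sph lam (hyp t)) := by
  have hw := wronskian_sphDecay hlam ht
  have hφ : sph lam (hyp t) ≠ 0 := (sph_hyp_pos lam t).ne'
  have hs : Real.sinh (2 * t) ≠ 0 := (sinh_two_mul_pos ht).ne'
  unfold greenSolI' greenSolI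
  field_simp
  linear_combination (-(greenBI (fun t => sph lam (hyp t)) g t)) * hw

/-- `|φ_λ′| ≤ √μ φ_λ` for `λ > 2`, `t ≥ 0` (row 486). -/
theorem abs_deriv_sph_hyp_le_sqrt_mul {lam : ℝ} (h2 : 2 < lam) {t : ℝ} (ht : 0 ≤ t) :
    |deriv (fun t => sph lam (hyp t)) t| ≤ Real.sqrt (lam * (lam - 2)) * sph lam (hyp t) := by
  have hμ : 0 < lam * (lam - 2) := mul_pos (by linarith) (by linarith)
  have h := deriv_sq_le_mu_mul_sq hμ ht
  have hφ : 0 < sph lam (hyp t) := sph_hyp_pos lam t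
  calc |deriv (fun t => sph lam (hyp t)) t| ≤ Real.sqrt (lam * (lam - 2) * sph lam (hyp t) ^ 2) :=
        Real.abs_le_sqrt h
    _ = Real.sqrt (lam * (lam - 2)) * sph lam (hyp t) := by
        rw [Real.sqrt_mul hμ.le, Real.sqrt_sq hφ.le]

variable (h2 : 2 < lam)

include hlam h2 hg hM hM0 hε hC in
/-- **`u′` is bounded near the origin** for `λ > 2` and a source of the class. -/
theorem eventually_abs_greenSolI'_le :
    ∃ B' : ℝ, ∀ᶠ t in 𝓝[>] (0 : ℝ), |greenSolI' (deriv fun t => sph lam (hyp t)) (sphDecay' lam)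
      (fun t => sph lam (hyp t)) (sphDecay lam) g t| ≤ B' := by
  have hA := integrableOn_sphDecay_mul_mul_sinh hlam hg hM hM0 hε hC
  obtain ⟨B, hB⟩ := eventually_abs_greenSolI_le hlam hM hM0 hA
  obtain ⟨Φ, hΦ0, hΦ⟩ := exists_sph_hyp_le lam
  have hsinh2 : 0 < Real.sinh 2 := Real.sinh_pos_iff.mpr two_pos
  refine ⟨Real.sqrt (lam * (lam - 2)) * B + Φ * M * Real.sinh 2 * Real.exp lam / 2, ?_⟩
  filter_upwards [hB, Ioo_mem_nhdsGT one_pos] with t hBt ht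
  have ht0 : 0 < t := ht.1
  have ht1 : t < 1 := ht.2
  rw [greenSolI'_eq hlam ht0]
  have hφ : 0 < sph lam (hyp t) := sph_hyp_pos lam t
  have hs : 0 < Real.sinh (2 * t) := sinh_two_mul_pos ht0
  have h1 : |deriv (fun t => sph lam (hyp t)) t / sph lam (hyp t)| ≤ Real.sqrt (lam * (lam - 2)) := by
    rw [abs_div, abs_of_pos hφ, div_le_iff₀ hφ]
    exact abs_deriv_sph_hyp_le_sqrt_mul h2 ht0.le
  have hBI := abs_greenBI_le hM hM0 hΦ hΦ0.le ht0 ht1.le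
  have hsinh : 2 * t ≤ Real.sinh (2 * t) := Real.self_le_sinh_iff.mpr (by linarith)
  have hφe : Real.exp (-lam) ≤ sph lam (hyp t) := by
    refine le_trans ?_ (exp_neg_mul_le_sph_hyp (by linarith) ht0.le)
    apply Real.exp_le_exp.mpr
    nlinarith
  have hE : 0 < Real.exp (-lam) := Real.exp_pos _
  have h2' : |greenBI (fun t => sph lam (hyp t)) g t / (Real.sinh (2 * t) * sph lam (hyp t))|
      ≤ Φ * M * Real.sinh 2 * Real.exp lam / 2 := by
    rw [abs_div, abs_of_pos (mul_pos hs hφ), div_le_iff₀ (mul_pos hs hφ)]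
    calc |greenBI (fun t => sph lam (hyp t)) g t| ≤ Φ * M * Real.sinh 2 * t := hBI
      _ = Φ * M * Real.sinh 2 * Real.exp lam / 2 * (2 * t * Real.exp (-lam)) := by
          rw [show Real.exp lam = (Real.exp (-lam))⁻¹ by rw [← Real.exp_neg, neg_neg]]
          field_simp
      _ ≤ Φ * M * Real.sinh 2 * Real.exp lam / 2 * (Real.sinh (2 * t) * sph lam (hyp t)) := by
          apply mul_le_mul_of_nonneg_left _ (by positivity)
          exact mul_le_mul hsinh hφe hE.le hs.le
  calc |deriv (fun t => sph lam (hyp t)) t / sph lam (hyp t) * greenSolI (fun t => sph lam (hyp t)) (sphDecay lam) g t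
        + greenBI (fun t => sph lam (hyp t)) g t / (Real.sinh (2 * t) * sph lam (hyp t))|
      ≤ |deriv (fun t => sph lam (hyp t)) t / sph lam (hyp t)| * |greenSolI (fun t => sph lam (hyp t)) (sphDecay lam) g t|
        + |greenBI (fun t => sph lam (hyp t)) g t / (Real.sinh (2 * t) * sph lam (hyp t))| := by
        rw [← abs_mul]; exact abs_add_le _ _
    _ ≤ Real.sqrt (lam * (lam - 2)) * B + Φ * M * Real.sinh 2 * Real.exp lam / 2 :=
        add_le_add (mul_le_mul h1 hBt (abs_nonneg _) (Real.sqrt_nonneg _)) h2'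

include hlam h2 hg hM hM0 hε hC in
/-- **`|u′(t)| ≤ K e^{−ε′ t}` beyond some `T`** for every `ε′ < min(ε, λ)`, `λ > 2`. -/
theorem exists_abs_greenSolI'_le_exp {ε' : ℝ} (hε' : ε' < min ε lam) :
    ∃ K T : ℝ, 0 ≤ K ∧ 0 < T ∧ ∀ t, T ≤ t → |greenSolI' (deriv fun t => sph lam (hyp t)) (sphDecay' lam)
      (fun t => sph lam (hyp t)) (sphDecay lam) g t| ≤ K * Real.exp (-ε' * t) := by
  -- an intermediate rate `ε″ ∈ (ε′, min(ε, λ))`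
  set ε'' := (ε' + min ε lam) / 2 with hε''
  have hε''1 : ε' < ε'' := by rw [hε'']; linarith
  have hε''2 : ε'' < min ε lam := by rw [hε'']; linarith
  obtain ⟨K₁, T₁, hK₁, hT₁, hKT₁⟩ := exists_abs_greenSolI_le_exp hlam hg hM hM0 hε hC hε''2
  obtain ⟨K₂, T₂, hK₂, hT₂, hKT₂⟩ := abs_greenBI_le_atTop hlam hg hM hM0 hC
  have hc : 0 < cfun (2 - lam) := cfun_pos (by linarith)
  obtain ⟨T₃, hT₃⟩ := eventually_atTop.mp (eventually_le_sph_hyp hlam)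
  set δ := ε'' - ε' with hδ
  have hδ0 : 0 < δ := by rw [hδ]; linarith
  set T := max (max T₁ T₂) (max T₃ 1) with hT
  have hT0 : 0 < T := lt_of_lt_of_le one_pos (le_trans (le_max_right T₃ 1) (le_max_right _ _))
  refine ⟨Real.sqrt (lam * (lam - 2)) * K₁ + 8 * K₂ / cfun (2 - lam) * (1 + 1 / δ), T, by positivity, hT0,
    fun t ht => ?_⟩
  have ht1 : 1 ≤ t := le_trans (le_trans (le_max_right T₃ 1) (le_max_right _ _)) ht
  have ht0 : 0 < t := lt_of_lt_of_le one_pos ht1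
  have htT₁ : T₁ ≤ t := le_trans (le_trans (le_max_left _ _) (le_max_left _ _)) ht
  have htT₂ : T₂ ≤ t := le_trans (le_trans (le_max_right _ _) (le_max_left _ _)) ht
  have htT₃ : T₃ ≤ t := le_trans (le_trans (le_max_left _ _) (le_max_right _ _)) ht
  rw [greenSolI'_eq hlam ht0]
  have hφ : 0 < sph lam (hyp t) := sph_hyp_pos lam t
  have hs : 0 < Real.sinh (2 * t) := sinh_two_mul_pos ht0
  have h1 : |deriv (fun t => sph lam (hyp t)) t / sph lam (hyp t)| ≤ Real.sqrt (lam * (lam - 2)) := by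
    rw [abs_div, abs_of_pos hφ, div_le_iff₀ hφ]
    exact abs_deriv_sph_hyp_le_sqrt_mul h2 ht0.le
  -- `1/(sinh 2t φ_λ) ≤ (8/c) e^{−λ t}`
  have hsinh : Real.exp (2 * t) / 4 ≤ Real.sinh (2 * t) := exp_div_four_le_sinh (by linarith)
  have hφl : cfun (2 - lam) / 2 * Real.exp ((lam - 2) * t) ≤ sph lam (hyp t) := hT₃ t htT₃
  have hprod : cfun (2 - lam) / 8 * Real.exp (lam * t) ≤ Real.sinh (2 * t) * sph lam (hyp t) := by
    calc cfun (2 - lam) / 8 * Real.exp (lam * t)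
        = Real.exp (2 * t) / 4 * (cfun (2 - lam) / 2 * Real.exp ((lam - 2) * t)) := by
          rw [show Real.exp (lam * t) = Real.exp (2 * t) * Real.exp ((lam - 2) * t) by
            rw [← Real.exp_add]; congr 1; ring]
          ring
      _ ≤ Real.sinh (2 * t) * sph lam (hyp t) := mul_le_mul hsinh hφl (by positivity) hs.le
  -- the head term
  have hB := hKT₂ t htT₂
  have h2' : |greenBI (fun t => sph lam (hyp t)) g t / (Real.sinh (2 * t) * sph lam (hyp t))|
      ≤ 8 * K₂ / cfun (2 - lam) * (1 + t) * Real.exp (-(min ε lam) * t) := by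
    rw [abs_div, abs_of_pos (mul_pos hs hφ), div_le_iff₀ (mul_pos hs hφ)]
    calc |greenBI (fun t => sph lam (hyp t)) g t| ≤ K₂ * (1 + t) * Real.exp (max (lam - ε) 0 * t) := hB
      _ = 8 * K₂ / cfun (2 - lam) * (1 + t) * Real.exp (-(min ε lam) * t)
          * (cfun (2 - lam) / 8 * Real.exp (lam * t)) := by
          have e : Real.exp (max (lam - ε) 0 * t) = Real.exp (-(min ε lam) * t) * Real.exp (lam * t) := by
            rw [← Real.exp_add]; congr 1
            have : max (lam - ε) 0 = lam - min ε lam := by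
              rcases le_total ε lam with h | h
              · rw [min_eq_left h, max_eq_left (by linarith)]
              · rw [min_eq_right h, max_eq_right (by linarith)]; ring
            rw [this]; ring
          rw [e]; field_simp
      _ ≤ 8 * K₂ / cfun (2 - lam) * (1 + t) * Real.exp (-(min ε lam) * t) * (Real.sinh (2 * t) * sph lam (hyp t)) :=
          mul_le_mul_of_nonneg_left hprod (by positivity)
  -- absorb `(1 + t)` and pass from `min(ε, λ)`, `ε″` to `ε′`
  have h1t : 1 + t ≤ (1 + 1 / δ) * Real.exp (δ * t) := by
    have ha : (1 : ℝ) ≤ Real.exp (δ * t) := Real.one_le_exp (by positivity)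
    have hb : t ≤ Real.exp (δ * t) / δ := le_exp_div hδ0
    calc 1 + t ≤ Real.exp (δ * t) + Real.exp (δ * t) / δ := add_le_add ha hb
      _ = (1 + 1 / δ) * Real.exp (δ * t) := by ring
  have hmin : Real.exp (-(min ε lam) * t) ≤ Real.exp (-ε'' * t) := by
    apply Real.exp_le_exp.mpr; nlinarith [hε''2]
  have hδe : Real.exp (δ * t) * Real.exp (-ε'' * t) = Real.exp (-ε' * t) := by
    rw [← Real.exp_add]; congr 1; rw [hδ]; ring
  have hu := hKT₁ t htT₁
  have hsum : |deriv (fun t => sph lam (hyp t)) t / sph lam (hyp t)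
        * greenSolI (fun t => sph lam (hyp t)) (sphDecay lam) g t
        + greenBI (fun t => sph lam (hyp t)) g t / (Real.sinh (2 * t) * sph lam (hyp t))|
      ≤ Real.sqrt (lam * (lam - 2)) * (K₁ * Real.exp (-ε'' * t))
        + 8 * K₂ / cfun (2 - lam) * (1 + t) * Real.exp (-(min ε lam) * t) := by
    calc |deriv (fun t => sph lam (hyp t)) t / sph lam (hyp t) * greenSolI (fun t => sph lam (hyp t)) (sphDecay lam) g t
          + greenBI (fun t => sph lam (hyp t)) g t / (Real.sinh (2 * t) * sph lam (hyp t))|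
        ≤ |deriv (fun t => sph lam (hyp t)) t / sph lam (hyp t)|
            * |greenSolI (fun t => sph lam (hyp t)) (sphDecay lam) g t|
          + |greenBI (fun t => sph lam (hyp t)) g t / (Real.sinh (2 * t) * sph lam (hyp t))| := by
          rw [← abs_mul]; exact abs_add_le _ _
      _ ≤ Real.sqrt (lam * (lam - 2)) * (K₁ * Real.exp (-ε'' * t))
          + 8 * K₂ / cfun (2 - lam) * (1 + t) * Real.exp (-(min ε lam) * t) :=
          add_le_add (mul_le_mul h1 hu (abs_nonneg _) (Real.sqrt_nonneg _)) h2'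
  have hA : Real.sqrt (lam * (lam - 2)) * (K₁ * Real.exp (-ε'' * t))
      ≤ Real.sqrt (lam * (lam - 2)) * (K₁ * Real.exp (-ε' * t)) := by
    apply mul_le_mul_of_nonneg_left _ (Real.sqrt_nonneg _)
    apply mul_le_mul_of_nonneg_left _ hK₁
    apply Real.exp_le_exp.mpr; nlinarith
  have hB' : 8 * K₂ / cfun (2 - lam) * (1 + t) * Real.exp (-(min ε lam) * t)
      ≤ 8 * K₂ / cfun (2 - lam) * ((1 + 1 / δ) * Real.exp (δ * t)) * Real.exp (-ε'' * t) :=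
    mul_le_mul (mul_le_mul_of_nonneg_left h1t (by positivity)) hmin (Real.exp_pos _).le (by positivity)
  have hfin : 8 * K₂ / cfun (2 - lam) * ((1 + 1 / δ) * Real.exp (δ * t)) * Real.exp (-ε'' * t)
      = 8 * K₂ / cfun (2 - lam) * (1 + 1 / δ) * Real.exp (-ε' * t) := by
    rw [mul_assoc (8 * K₂ / cfun (2 - lam)), mul_assoc (1 + 1 / δ), hδe]
    ring
  calc _ ≤ _ := hsum
    _ ≤ Real.sqrt (lam * (lam - 2)) * (K₁ * Real.exp (-ε' * t))
        + 8 * K₂ / cfun (2 - lam) * ((1 + 1 / δ) * Real.exp (δ * t)) * Real.exp (-ε'' * t) := add_le_add hA hB'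
    _ = (Real.sqrt (lam * (lam - 2)) * K₁ + 8 * K₂ / cfun (2 - lam) * (1 + 1 / δ)) * Real.exp (-ε' * t) := by
        rw [hfin]; ring

end measure

end Summit.Ventures.HodgeRepro2.T5SU11ImproperDerivativeIdentity
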